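import Summits.ResolutionOfSingularities.ResolutionOfSingularities.Theorems.WildConesClassicalRegimesDefs
import Summits.ResolutionOfSingularities.ResolutionOfSingularities.Theorems.WildConesClassicalRegimesStubMuDropCurve
import Summits.ResolutionOfSingularities.ResolutionOfSingularities.Theorems.WildConesClassicalRegimesStubOrdPExitSurface
import Summits.ResolutionOfSingularities.ResolutionOfSingularities.Theorems.WildConesClassicalRegimesStubHighOrdNotIsol
import Summits.ResolutionOfSingularities.ResolutionOfSingularities.Theorems.WildConesClassicalRegimesStubCaseAExitOrdSucc
import Summits.ResolutionOfSingularities.ResolutionOfSingularities.Theorems.WildConesClassicalRegimesStubMuDropSurfaceOrdSucc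

/-!
# Crux `ClassicalRegimes` (stmt-ResolutionOfSingularities-16884) — line `milnor-descent`, lead's skeleton (v5)

Route `ResolutionOfSingularities/WildCones`, crux #5: `ClassicalRegimes` = the route's TARGET
`IsolatedForcedTermination` (no infinite run of the point-blow-up dynamics of a height-one atom
`z^p = a(u_1..u_n)` over a perfect field of characteristic `p` has every state ISOLATED of
multiplicity `p`) restricted to the classical regimes `n ≤ 2 ∨ p = 2`.

The dynamics, the predicates `Isol`/`MultP`/`OrdP`/`OrdPSucc`, the colength `mu` and the bridge
`classicalRegimes_iff` (`Iff.rfl`) are the Theorems-side `Theorems/WildConesClassicalRegimesDefs.lean`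
(landed p166950). LANDED stubs are imported: `stub_muDropCurve` (p167868), `stub_ordPExitSurface`
(p167807), `stub_highOrdNotIsol` (p167818), `stub_caseAExitOrdSucc` (p168984), `stub_muDropSurfaceOrdSucc` (p169380). The ONE OPEN stub is the `sorry` below.

## The line: `μ` is a strict Lyapunov function along isolated multiplicity-`p` runs, classical regimes

* n = 1: `stub_muDropCurve` (μ = ord − 1 drops by p). LANDED.
* n = 2: `stub_ordPExitSurface` (order p ⇒ no multiplicity-p successor, LANDED) and
  `stub_highOrdNotIsol` (order ≥ p+2 ⇒ no isolated successor, LANDED) force every state of an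
  infinite run to have cleaned order exactly p+1; then `stub_muDropSurfaceOrdSucc` (LANDED, lead):
  `μ(c') ≤ r + dim O'/J'` (J' the weak transform of the gradient ideal, r ≤ p+1 the root multiplicity
  of the near point), `dim O'/J' ≤ dim R/J^c − dim R/𝔪^p` (Huneke–Swanson 14.3.4, in tree), `J^c ⊋ J`
  (a contracted 𝔪-primary ideal of order p is 𝔪-full, needs ≥ p+1 > 2 generators), so μ drops.
* p = 2, n ≥ 3: `stub_highOrdNotIsol` + `stub_caseAExitOrdSucc` (LANDED; n ≥ 3, order p+1 ⇒ an isolated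
  successor is not of multiplicity p) force every state to have order exactly 2, and
  `stub_muDropCharTwoOrdP` (OPEN) is the drop for an order-2 state with order-2 successor.
* `ClassicalRegimes_of` — PROVED composition: μ drops at every step of an infinite run, regime by
  regime, and a strictly decreasing ℕ-sequence is absurd.

Disproof used (Cruxes/ClassicalRegimes/Disproof.lean): `Isol`, `MultP`, `p.Prime` load-bearing — all
are hypotheses of every stub; `PerfectField` not load-bearing; §3 tightness μ − μ' = p² − p − 1 ⇒ the
surface bound must be sharp at p = 2 (p(p−1)/2 = 1 is).
-/

noncomputable section

-- single-problem summit: the doubled namespace component `ResolutionOfSingularities` is forced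
set_option linter.dupNamespace false

open scoped BigOperators Classical

open Summit.ResolutionOfSingularities.ResolutionOfSingularities.Theses.WildCones (ClassicalRegimes)

namespace Summit.ResolutionOfSingularities.ResolutionOfSingularities.Theorems.WildCones

/-! ## The one OPEN stub STATEMENT by name (`Sig.stub_<name>`) -/

/-- Statement of `stub_muDropCharTwoOrdP` (`p = 2`, `n ≥ 3`, state and successor both isolated of
multiplicity `2` and cleaned order exactly `2`): the Milnor number drops.
[cite: arXiv:2507.17078, Thm 3.5 and Cor 3.7] -/
def Sig.stub_muDropCharTwoOrdP : Prop :=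
  ∀ n : ℕ, 3 ≤ n → ∀ (κ : Type) [Field κ] [CharP κ 2] [PerfectField κ]
    (c : (Fin n → ℕ) → κ) (i : Fin n) (τ : Fin n → κ),
    Isol 2 n κ c → MultP 2 n κ c → OrdP 2 n κ c → Isol 2 n κ (step 2 n κ i τ c) →
      MultP 2 n κ (step 2 n κ i τ c) → OrdP 2 n κ (step 2 n κ i τ c) →
        mu 2 n κ (step 2 n κ i τ c) < mu 2 n κ c

/-! ## The composition (kernel-checked; no `sorry` in its own closure except through `stub_*`) -/

/-- A strictly decreasing sequence of natural numbers is absurd. [folklore] -/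
theorem no_strictAnti_nat (f : ℕ → ℕ) (h : ∀ m, f (m + 1) < f m) : False := by
  have key : ∀ m, f m + m ≤ f 0 := by
    intro m
    induction m with
    | zero => simp
    | succ m ih => have := h m; omega
  have := key (f 0 + 1)
  omega

/-- **Surfaces (`n = 2`, every `p`): `μ` drops at every step of an infinite isolated multiplicity-`p`
run** — the order-`p` exit and the high-order exit force every state to have cleaned order exactly
`p + 1`, and then the order-`(p+1)` drop applies (all three LANDED). [folklore] -/
theorem mu_lt_of_infRun_two {p : ℕ} (hp : p.Prime) {κ : Type}
    [Field κ] [CharP κ p] [PerfectField κ] {c₀ : (Fin 2 → ℕ) → κ} {i : ℕ → Fin 2} {t : ℕ → Fin 2 → κ}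
    (hall : InfRun p 2 κ c₀ i t) (m : ℕ) :
    mu p 2 κ (run p 2 κ c₀ i t (m + 1)) < mu p 2 κ (run p 2 κ c₀ i t m) := by
  -- every state of the run has cleaned order exactly `p + 1`
  have hO : ∀ k, ¬ OrdP p 2 κ (run p 2 κ c₀ i t k) := fun k hO =>
    stub_ordPExitSurface p hp κ _ (i k) (t k) (hall k).2 hO (hall (k + 1)).2
  have hS : ∀ k, OrdPSucc p 2 κ (run p 2 κ c₀ i t k) := fun k => by
    by_contra hS
    exact stub_highOrdNotIsol p hp 2 le_rfl κ _ (i k) (t k) (hall k).2 (hO k) hS (hall (k + 1)).1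
  exact stub_muDropSurfaceOrdSucc p hp κ _ (i m) (t m) (hall m).1 (hall m).2 (hO m) (hS m) (hall (m + 1)).1
    (hall (m + 1)).2 (hO (m + 1))

/-- **Characteristic two, `n ≥ 3`: `μ` drops at every step of an infinite isolated double run** —
a state of cleaned order `≥ 3` has no isolated double successor (Case A / high-order exit), so every
state has cleaned order exactly `2` and the char-two drop applies. [folklore] -/
theorem mu_lt_of_infRun_charTwo (h4 : Sig.stub_muDropCharTwoOrdP)
    {n : ℕ} (hn : 3 ≤ n) {κ : Type} [Field κ] [CharP κ 2] [PerfectField κ] {c₀ : (Fin n → ℕ) → κ}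
    {i : ℕ → Fin n} {t : ℕ → Fin n → κ} (hall : InfRun 2 n κ c₀ i t) (m : ℕ) :
    mu 2 n κ (run 2 n κ c₀ i t (m + 1)) < mu 2 n κ (run 2 n κ c₀ i t m) := by
  -- every state of the run has cleaned order exactly `2`
  have hO : ∀ k, OrdP 2 n κ (run 2 n κ c₀ i t k) := fun k => by
    by_contra hO
    by_cases hS : OrdPSucc 2 n κ (run 2 n κ c₀ i t k)
    · exact stub_caseAExitOrdSucc 2 Nat.prime_two n hn κ _ (i k) (t k) (hall k).2 hO hS (hall (k + 1)).1
        (hall (k + 1)).2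
    · exact stub_highOrdNotIsol 2 Nat.prime_two n (by omega) κ _ (i k) (t k) (hall k).2 hO hS
        (hall (k + 1)).1
  exact h4 n hn κ _ (i m) (t m) (hall m).1 (hall m).2 (hO m) (hall (m + 1)).1 (hall (m + 1)).2
    (hO (m + 1))

/-- **`ClassicalRegimes` from the ONE OPEN stub statement (and the five landed stubs)** — the
assembly, PROVED: re-point the crux (`classicalRegimes_iff`), show that `μ` drops at every step of an
infinite isolated multiplicity-`p` run regime by regime (`n = 1`: `stub_muDropCurve`; `n = 2`:
`mu_lt_of_infRun_two`; `p = 2 ∧ n ≥ 3`: `mu_lt_of_infRun_charTwo`), and conclude by `no_strictAnti_nat`.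
[folklore] -/
theorem ClassicalRegimes_of : Sig.stub_muDropCharTwoOrdP → ClassicalRegimes := by
  intro h4
  rw [classicalRegimes_iff]
  intro p hp n hn hreg κ _ _ _ c₀ i t hall
  refine no_strictAnti_nat (fun m => mu p n κ (run p n κ c₀ i t m)) fun m => ?_
  by_cases hle : n ≤ 2
  · interval_cases n
    · exact stub_muDropCurve p hp κ _ (i m) (t m) (hall m).1 (hall m).2 (hall (m + 1)).1 (hall (m + 1)).2
    · exact mu_lt_of_infRun_two hp hall m
  · rcases hreg with hle' | rfl
    · exact absurd hle' hle
    · exact mu_lt_of_infRun_charTwo h4 (by omega) hall m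

/-! ## The open stubs -/

/-- **STUB (p = 2, n ≥ 3, state and successor of cleaned order exactly 2; size L).**
[cite: arXiv:2507.17078, Thm 3.5 and Cor 3.7] -/
theorem stub_muDropCharTwoOrdP :
    ∀ n : ℕ, 3 ≤ n → ∀ (κ : Type) [Field κ] [CharP κ 2] [PerfectField κ]
    (c : (Fin n → ℕ) → κ) (i : Fin n) (τ : Fin n → κ),
    Isol 2 n κ c → MultP 2 n κ c → OrdP 2 n κ c → Isol 2 n κ (step 2 n κ i τ c) →
      MultP 2 n κ (step 2 n κ i τ c) → OrdP 2 n κ (step 2 n κ i τ c) →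
        mu 2 n κ (step 2 n κ i τ c) < mu 2 n κ c := by
  sorry

/-- **The crux `ClassicalRegimes`, assembled** (the only `sorry` in its closure is the one open stub). -/
theorem ClassicalRegimes_proof : ClassicalRegimes :=
  ClassicalRegimes_of stub_muDropCharTwoOrdP

end Summit.ResolutionOfSingularities.ResolutionOfSingularities.Theorems.WildCones

end
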